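import Summits.CriticalPhenomena.PercolationContinuityZ3.Theorems.PercNearOneGluingNoHeavyLowerTailMajorityGluingQCertSymSound
import HarnessLib

/-!
# Relabelling the relays: the orbit property of the symmetrised moments of the cut laws (lane prim-rate, constants-miner 1, gen 36; CANDIDATES §GEN-36, NEXT-g37)

Support file for the closed crux `NoHeavyLowerTail` (stmt-CriticalPhenomena-4575), majority-gluing line; companion of `…MajorityGluingQCertSym` /
`…QCertSymSound` (the objects `pull`, `permN`, `classPerm`, `lawFam`, `Msym`, `valS` are defined in `…QCertSym`).  For an enumeration `t : Fin k → Fin n` of `k` relays and a permutation `g` of `Fin k`, the cut law of the relabelled enumeration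
`t ∘ g` is the cut law of `t` read through relabelled patterns: **`lawvK w a₀ (t ∘ g) δ K = lawvK w a₀ t δ (pull k (g⁻¹)ᴺ K)`** (`lawvK_comp`, `encK_comp`).  Consequently the symmetrised moments `Msym v i j = Σ_g v_g(i)·v_g(j)` of the family `v_g = lawvK w a₀ (t ∘ g) δ`
(`lawFam`) are invariant under relabelling both indices (`Msym_pull`), and since the canonical form `canonPair k i j` IS a relabelling by the permutation
`classPerm k i j` (the relays sorted by membership class: `classList_perm`, `unrank_eq`), the key valuation `valS v N key = Msym v (key / N) (key % N)`
has the ORBIT PROPERTY `valS v NV (keyS k i j) = Msym v i j` (`valS_keyS`) required by `SymCert.soundS`.  No sorries. [folklore]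
-/

noncomputable section

namespace Summit.CriticalPhenomena.PercolationContinuityZ3.Theorems

open MeasureTheory Set
open Literature.Probability.LatticeModels (prodBernoulli)
open Literature.Probability.Percolation
open scoped Classical

namespace HubOnly
namespace QCert

variable {n k : ℕ}

/-! ### Bits of relabelled patterns -/

/-- The bits of `pull`: bit `p` of `pull m σ K` is bit `σ p` of `K` (`K < 2^m`). -/
theorem testBit_pull (m : ℕ) (σ : ℕ → ℕ) {K : ℕ} (hK : K < 2 ^ m) (p : ℕ) :
    (pull m σ K).testBit p = (decide (p < m) && K.testBit (σ p)) := by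
  unfold pull; rw [if_pos hK, testBit_code, tb_eq]

/-- `pull` stays below `2^m`. -/
theorem pull_lt (m : ℕ) (σ : ℕ → ℕ) {K : ℕ} (hK : K < 2 ^ m) : pull m σ K < 2 ^ m := by
  unfold pull; rw [if_pos hK]; exact code_lt m _

/-- `pull` fixes the indices `≥ 2^m`. -/
theorem pull_of_not_lt (m : ℕ) (σ : ℕ → ℕ) {K : ℕ} (hK : ¬ K < 2 ^ m) : pull m σ K = K := by
  unfold pull; rw [if_neg hK]

/-- `pull` preserves `< 2^m + 1` (the variable range). -/
theorem pull_lt_NV (m : ℕ) (σ : ℕ → ℕ) {K : ℕ} (hK : K < 2 ^ m + 1) : pull m σ K < 2 ^ m + 1 := by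
  by_cases h : K < 2 ^ m
  · exact lt_trans (pull_lt m σ h) (by omega)
  · rw [pull_of_not_lt m σ h]; exact hK

/-- **Inverse relabellings cancel:** if `τ (σ p) = p` and `σ p < m` for `p < m`, then `pull m σ (pull m τ K) = K` (`K < 2^m`). -/
theorem pull_pull (m : ℕ) (σ τ : ℕ → ℕ) (hστ : ∀ p < m, τ (σ p) = p) (hσ : ∀ p < m, σ p < m) {K : ℕ} (hK : K < 2 ^ m) :
    pull m σ (pull m τ K) = K := by
  refine Nat.eq_of_testBit_eq fun p => ?_
  rw [testBit_pull m σ (pull_lt m τ hK)]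
  by_cases hp : p < m
  · rw [testBit_pull m τ hK, hστ p hp]; simp [hp, hσ p hp]
  · have hKp : K < 2 ^ p := lt_of_lt_of_le hK (Nat.pow_le_pow_right (by norm_num) (by omega))
    rw [Nat.testBit_lt_two_pow hKp]; simp [hp]

/-! ### A permutation of `Fin m` as a function on `ℕ` -/

/-- `permN σ` maps `[0, m)` into `[0, m)`. -/
theorem permN_lt {m : ℕ} (σ : Equiv.Perm (Fin m)) {p : ℕ} (hp : p < m) : permN σ p < m := by
  unfold permN; rw [dif_pos hp]; exact (σ ⟨p, hp⟩).isLt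

/-- `permN σ` on `Fin m` is `σ`. -/
theorem permN_apply {m : ℕ} (σ : Equiv.Perm (Fin m)) (p : Fin m) : permN σ p = σ p := by
  unfold permN; rw [dif_pos p.isLt]

/-- `permN σ⁻¹` undoes `permN σ` below `m`. -/
theorem permN_inv_apply {m : ℕ} (σ : Equiv.Perm (Fin m)) {p : ℕ} (hp : p < m) : permN σ⁻¹ (permN σ p) = p := by
  have h1 : permN σ p = ((σ ⟨p, hp⟩ : Fin m) : ℕ) := by unfold permN; rw [dif_pos hp]
  rw [h1, permN_apply σ⁻¹ (σ ⟨p, hp⟩), Equiv.Perm.inv_def, Equiv.symm_apply_apply]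

/-- `pull (σ⁻¹)ᴺ ∘ pull σᴺ = id` below `2^m`. -/
theorem pull_permN_inv {m : ℕ} (σ : Equiv.Perm (Fin m)) {K : ℕ} (hK : K < 2 ^ m) : pull m (permN σ⁻¹) (pull m (permN σ) K) = K :=
  pull_pull m _ _ (fun p hp => by
    have := permN_inv_apply σ⁻¹ hp; rwa [inv_inv] at this) (fun p hp => permN_lt _ hp) hK

/-! ### The cut code and the cut law of a relabelled enumeration -/

/-- **The cut code of `t ∘ g` is the relabelled cut code of `t`.** -/
theorem encK_comp (a₀ : Fin n) (t : Fin k → Fin n) (g : Equiv.Perm (Fin k)) (ω : BondConfig (Fin n)) :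
    encK a₀ (t ∘ g) ω = pull k (permN g) (encK a₀ t ω) := by
  refine Nat.eq_of_testBit_eq fun p => ?_
  rw [testBit_pull k _ (encK_lt a₀ t ω)]
  by_cases hp : p < k
  · rw [testBit_encK_of_lt a₀ (t ∘ g) ω p hp, testBit_encK_of_lt a₀ t ω _ (permN_lt g hp)]
    have : (t ∘ ⇑g) ⟨p, hp⟩ = t ⟨permN g p, permN_lt g hp⟩ := by
      rw [Function.comp_apply]; congr 1; exact Fin.ext (permN_apply g ⟨p, hp⟩).symm
    simp only [hp, decide_true, Bool.true_and, this]
  · rw [testBit_encK_of_ge a₀ (t ∘ g) ω p (by omega)]; simp [hp]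

/-- **The cut law of a relabelled enumeration:** `lawvK w a₀ (t ∘ g) δ K = lawvK w a₀ t δ (pull k (g⁻¹)ᴺ K)`. [folklore] -/
theorem lawvK_comp (w : Sym2 (Fin n) → unitInterval) (a₀ : Fin n) (t : Fin k → Fin n) (g : Equiv.Perm (Fin k)) (δ : ℝ) (K : ℕ) :
    lawvK w a₀ (t ∘ g) δ K = lawvK w a₀ t δ (pull k (permN g⁻¹) K) := by
  by_cases hK : K < 2 ^ k
  · have hK' : pull k (permN g⁻¹) K < 2 ^ k := pull_lt k _ hK
    unfold lawvK
    rw [if_pos hK, if_pos hK']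
    congr 1
    ext ω
    simp only [mem_setOf_eq, encK_comp]
    constructor
    · intro h; rw [← h, pull_permN_inv g (encK_lt a₀ t ω)]
    · intro h
      rw [h]
      have := pull_permN_inv g⁻¹ hK
      rwa [inv_inv] at this
  · unfold lawvK; rw [pull_of_not_lt k _ hK, if_neg hK, if_neg hK]

/-! ### Invariance of the symmetrised moments -/

/-- **`Msym` of the family of relabelled cut laws is invariant under relabelling both indices.** -/
theorem Msym_pull (w : Sym2 (Fin n) → unitInterval) (a₀ : Fin n) (t : Fin k → Fin n) (δ : ℝ) (σ : Equiv.Perm (Fin k)) (i j : ℕ) :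
    Msym (lawFam w a₀ t δ) (pull k (permN σ) i) (pull k (permN σ) j) = Msym (lawFam w a₀ t δ) i j := by
  unfold Msym lawFam
  have h : ∀ g : Equiv.Perm (Fin k), ∀ K, lawvK w a₀ (t ∘ g) δ (pull k (permN σ) K) = lawvK w a₀ (t ∘ ⇑(g * σ⁻¹)) δ K := by
    intro g K
    rw [Equiv.Perm.coe_mul, ← Function.comp_assoc, lawvK_comp w a₀ (t ∘ g) σ⁻¹ δ K, inv_inv]
  simp_rw [h]
  exact Equiv.sum_comp (Equiv.mulRight σ⁻¹) (fun g => lawvK w a₀ (t ∘ g) δ i * lawvK w a₀ (t ∘ g) δ j)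

/-! ### The canonical relabelling and the key valuation -/

/-- `unrank` is the `ℕ`-extension of `classPerm`. -/
theorem unrank_eq (m i j : ℕ) (p : ℕ) : unrank m i j p = permN (classPerm m i j) p := by
  unfold unrank permN
  by_cases hp : p < m
  · rw [dif_pos hp, List.getD_eq_getElem _ _ (by rw [classList_length]; exact hp)]
    rfl
  · rw [dif_neg hp, List.getD_eq_default _ _ (by rw [classList_length]; omega)]

/-- `pull` along `unrank` is `pull` along `classPerm`. -/
theorem pull_unrank (m i j K : ℕ) : pull m (unrank m i j) K = pull m (permN (classPerm m i j)) K := by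
  have : unrank m i j = permN (classPerm m i j) := funext (unrank_eq m i j)
  rw [this]

/-- Decoding `enc2`. -/
theorem dec_enc2 {N a b : ℕ} (hb : b < N) : enc2 N (a, b) % N = b ∧ enc2 N (a, b) / N = a := by
  have hN : 0 < N := by omega
  unfold enc2
  exact ⟨by rw [Nat.add_mul_mod_self_left, Nat.mod_eq_of_lt hb], by rw [Nat.add_mul_div_left _ _ hN, Nat.div_eq_of_lt hb, zero_add]⟩

/-- **ORBIT PROPERTY:** for the family of relabelled cut laws, `valS (keyS k i j) = Msym i j` for all variables `i, j < 2^k + 1`. -/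
theorem valS_keyS (w : Sym2 (Fin n) → unitInterval) (a₀ : Fin n) (t : Fin k → Fin n) (δ : ℝ) (i j : ℕ) (hi : i < 2 ^ k + 1)
    (hj : j < 2 ^ k + 1) : valS (lawFam w a₀ t δ) (2 ^ k + 1) (keyS k i j) = Msym (lawFam w a₀ t δ) i j := by
  unfold keyS valS
  split_ifs with h
  · unfold canonPair
    obtain ⟨h1, h2⟩ := dec_enc2 (N := 2 ^ k + 1) (a := pull k (unrank k i j) i) (pull_lt_NV k (unrank k i j) hj)
    rw [h1, h2, pull_unrank, pull_unrank, Msym_pull]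
  · unfold canonPair
    obtain ⟨h1, h2⟩ := dec_enc2 (N := 2 ^ k + 1) (a := pull k (unrank k j i) j) (pull_lt_NV k (unrank k j i) hi)
    rw [h1, h2, pull_unrank, pull_unrank, Msym_pull, Msym_comm]

end QCert
end HubOnly

end Summit.CriticalPhenomena.PercolationContinuityZ3.Theorems

end
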